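import Summits.ResolutionOfSingularities.ResolutionOfSingularities.Theorems.WildConesClassicalRegimesSurfaceDict
import Literature.AlgebraicGeometry.Resolution.PlaneChartColengthDrop
import Literature.AlgebraicGeometry.Resolution.PlaneChartNearPoint

/-!
# Crux `ClassicalRegimes` (stmt-ResolutionOfSingularities-16884), line `milnor-descent` —
# stub `stub_muDropSurfaceOrdSucc`: the surface Milnor drop at cleaned order `p + 1` (lead)

For a two-variable state `c` (surface `z^p = a(u_i, u_j)`) which is isolated of multiplicity `p` and
cleaned order exactly `p + 1`, and a successor `c' = step p 2 κ i τ c` which is isolated of multiplicity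
`p` and cleaned order `≥ p + 1`: `mu c' < mu c`.

Proof (all colength bookkeeping over `κ`). Let `a = ser c ∈ 𝔪ᵖ⁺¹`, `J = (∂_i a, ∂_j a) ≤ 𝔪ᵖ` its
gradient ideal (`mu c = dim R/J`), `σ = chartMap 2 κ i τ` the chart endomorphism
`X_i ↦ X_i, X_j ↦ X_i (X_j + τ_j)`. The dictionary (`surfaceDict`) gives `T` with `σ a = X_iᵖ T`, the
successor's gradient ideal `(∂_i T, ∂_j T)`, and the chain rule `X_iᵖ ∂_j T = σ(∂_j a) X_i`,
`X_iᵖ ∂_i T = σ(∂_i a) + (X_j + τ_j) σ(∂_j a)`. Writing `σ(∂_l a) = X_iᵖ G_l` (`∂_l a ∈ 𝔪ᵖ`):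
`∂_j T = X_i G_j`, `∂_i T = G_i + (X_j + τ_j) G_j`, so `jac c' = (∂_i T) + (X_i G_j)` and with the
WEAK TRANSFORM `J' = (G_i, G_j)`: `Θ(J) R = X_iᵖ J'` and
`mu c' ≤ dim R/((∂_i T) + (X_i)) + dim R/((∂_i T) + (G_j)) = r + dim R/J'` (right-exactness), where
`r ≤ p + 1` and a transversal element `f ∈ J`, `f ∉ (X_i) + 𝔪ᵖ⁺¹` exist because the near point has
high contact (`MultP c' ∧ ¬OrdP c'`: the `X_i`-linear slice of `T` vanishes below `X_jᵖ`;
`Literature…PlaneChartNearPoint`). Then `dim R/J' + dim R/𝔪ᵖ < dim R/J` (Huneke–Swanson 14.3.4 and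
non-contractedness of two-generated ideals, `Literature…PlaneChartColengthDrop`) and
`dim R/𝔪ᵖ ≥ p + 1` give `mu c' ≤ mu c − 1`.
-/

noncomputable section

-- single-problem summit: the doubled namespace component `ResolutionOfSingularities` is forced
set_option linter.dupNamespace false

open scoped BigOperators Classical
open MvPowerSeries IsLocalRing Finsupp Module
open Literature.RingTheory.MvPowerSeries.Jets Literature.RingTheory.Length
open Literature.AlgebraicGeometry.Resolution.PlaneChart

namespace Summit.ResolutionOfSingularities.ResolutionOfSingularities.Theorems.WildCones

open Summit.ResolutionOfSingularities.ResolutionOfSingularities.Theorems.FrobeniusClosing (chartSubst chartMap)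
open Summit.ResolutionOfSingularities.ResolutionOfSingularities.Theorems.FrobeniusClosing.FactorizationProof
  (hasSubst_chartSubst chartMap_X_self chartMap_X_of_ne)

namespace MuDropSurface

variable {p : ℕ} {κ : Type} [Field κ]

/-- Coefficients of the cleaned series. [folklore] -/
theorem coeff_ser (c : (Fin 2 → ℕ) → κ) (A : Fin 2 →₀ ℕ) : coeff A (ser p 2 κ c) = clean p 2 κ c ⇑A := rfl

/-- The sum of an exponent on `Fin 2` is its degree. [folklore] -/
theorem sum_eq_degree (A : Fin 2 →₀ ℕ) : Finset.sum Finset.univ (fun l => A l) = A.degree :=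
  (Finsupp.degree_eq_sum A).symm

/-- `MultP ∧ ¬OrdP`: the cleaned series lies in `𝔪ᵖ⁺¹`. [folklore] -/
theorem ser_mem_pow_succ {c : (Fin 2 → ℕ) → κ} (hM : MultP p 2 κ c) (hO : ¬ OrdP p 2 κ c) :
    ser p 2 κ c ∈ maximalIdeal (MvPowerSeries (Fin 2) κ) ^ (p + 1) := by
  refine mem_maximalIdeal_pow_of_coeff_eq_zero fun A hA => ?_
  by_contra hne
  have h1 : p ≤ Finset.sum Finset.univ (fun l => A l) := hM.2 _ hne
  have h2 : Finset.sum Finset.univ (fun l => A l) ≠ p := fun h => hO ⟨_, hne, h⟩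
  rw [sum_eq_degree] at h1 h2
  omega

/-- Partials of a series in `𝔪ᵖ⁺¹` lie in `𝔪ᵖ`. [folklore] -/
theorem pd_mem_pow {f : MvPowerSeries (Fin 2) κ} (hf : f ∈ maximalIdeal (MvPowerSeries (Fin 2) κ) ^ (p + 1))
    (l : Fin 2) : pd 2 κ l f ∈ maximalIdeal (MvPowerSeries (Fin 2) κ) ^ p := by
  refine mem_maximalIdeal_pow_of_coeff_eq_zero fun A hA => ?_
  rw [MuDropSurface.coeff_pd, coeff_eq_zero_of_mem_maximalIdeal_pow hf, mul_zero]
  rw [map_add, degree_single]; omega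

/-- The range of a function on `Fin 2` is the pair of its values (`j ≠ i`). [folklore] -/
theorem range_eq_pair {i j : Fin 2} (hij : j ≠ i) {α : Type} (F : Fin 2 → α) : Set.range F = {F i, F j} := by
  ext y
  simp only [Set.mem_range, Set.mem_insert_iff, Set.mem_singleton_iff]
  constructor
  · rintro ⟨l, rfl⟩
    rcases OrdPExitSurface.eq_or_eq i j hij l with rfl | rfl
    · exact Or.inl rfl
    · exact Or.inr rfl
  · rintro (rfl | rfl)
    exacts [⟨i, rfl⟩, ⟨j, rfl⟩]

/-- `jac` as the ideal generated by the two partials. [folklore] -/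
theorem jac_eq_span_pair {i j : Fin 2} (hij : j ≠ i) (c : (Fin 2 → ℕ) → κ) :
    jac p 2 κ c = Ideal.span {pd 2 κ i (ser p 2 κ c), pd 2 κ j (ser p 2 κ c)} := by
  unfold jac
  rw [range_eq_pair hij]

end MuDropSurface

open MuDropSurface in
/-- **STUB `stub_muDropSurfaceOrdSucc` (n = 2, cleaned order exactly `p + 1`; the surface drop,
lead).** See the module docstring. [cite: HunekeSwanson2006, Lemma 14.3.4 and §14.1] -/
theorem stub_muDropSurfaceOrdSucc :
    ∀ p : ℕ, p.Prime → ∀ (κ : Type) [Field κ] [CharP κ p] [PerfectField κ]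
    (c : (Fin 2 → ℕ) → κ) (i : Fin 2) (τ : Fin 2 → κ),
    Isol p 2 κ c → MultP p 2 κ c → ¬ OrdP p 2 κ c → OrdPSucc p 2 κ c →
      Isol p 2 κ (step p 2 κ i τ c) → MultP p 2 κ (step p 2 κ i τ c) → ¬ OrdP p 2 κ (step p 2 κ i τ c) →
        mu p 2 κ (step p 2 κ i τ c) < mu p 2 κ c := by
  intro p hp κ _ _ _ c i τ hI hM hO hS hI' hM' hO'
  classical
  obtain ⟨j, hij⟩ : ∃ j : Fin 2, j ≠ i := ⟨i + 1, by fin_cases i <;> decide⟩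
  -- notation: `Θ = σ_{i,τ}` as an algebra hom (`a = ser p 2 κ c` is written out)
  let Θ : MvPowerSeries (Fin 2) κ →ₐ[κ] MvPowerSeries (Fin 2) κ := substAlgHom (hasSubst_chartSubst i τ)
  have hΘ : ∀ f, Θ f = chartMap 2 κ i τ f := fun f => by
    change substAlgHom (hasSubst_chartSubst i τ) f = MvPowerSeries.subst (chartSubst 2 κ i τ) f
    rw [← coe_substAlgHom (hasSubst_chartSubst i τ)]
  have hΘi : Θ (X i) = X i := by rw [hΘ]; exact chartMap_X_self i τ
  have hΘj : Θ (X j) = X i * (X j + C (τ j)) := by rw [hΘ]; exact chartMap_X_of_ne i τ hij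
  -- the dictionary and the chain rule
  obtain ⟨T, hdict, hpdT, hTj, hTi⟩ := surfaceDict p hp κ c i j hij τ hM
  -- orders
  have ham : ser p 2 κ c ∈ maximalIdeal _ ^ (p + 1) := ser_mem_pow_succ hM hO
  have hpdm : ∀ l, pd 2 κ l (ser p 2 κ c) ∈ maximalIdeal _ ^ p := pd_mem_pow ham
  have hJm : jac p 2 κ c ≤ maximalIdeal _ ^ p := by
    rw [jac_eq_span_pair hij, Ideal.span_le]
    rintro _ (rfl | rfl)
    · exact hpdm i
    · exact hpdm j
  -- `σ(∂_l a) = X_i^p G_l`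
  have hXi0 : (X i : MvPowerSeries (Fin 2) κ) ≠ 0 := X_ne_zero' i
  have hXip0 : (X i : MvPowerSeries (Fin 2) κ) ^ p ≠ 0 := pow_ne_zero _ hXi0
  obtain ⟨Gi, hGi⟩ := X_pow_dvd_of_mem_maximalIdeal_pow hij (τ j) Θ hΘi hΘj (hpdm i)
  obtain ⟨Gj, hGj⟩ := X_pow_dvd_of_mem_maximalIdeal_pow hij (τ j) Θ hΘi hΘj (hpdm j)
  rw [hΘ] at hGi hGj
  -- `∂_j T = X_i G_j`, `∂_i T = G_i + (X_j + τ_j) G_j`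
  have hpdTj : pd 2 κ j T = X i * Gj := by
    apply mul_left_cancel₀ hXip0
    rw [hTj, hGj]; ring
  have hpdTi : pd 2 κ i T = Gi + Gj * (X j + C (τ j)) := by
    apply mul_left_cancel₀ hXip0
    rw [hTi, hGi, hGj]; ring
  -- the two gradient ideals and the weak transform
  set J' : Ideal (MvPowerSeries (Fin 2) κ) := Ideal.span {Gi, Gj} with hJ'def
  set K : Ideal (MvPowerSeries (Fin 2) κ) := Ideal.span {pd 2 κ i T} with hKdef
  have hjac' : jac p 2 κ (step p 2 κ i τ c) = K ⊔ Ideal.span {X i * Gj} := by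
    rw [jac_eq_span_pair hij, hpdT i, hpdT j, hpdTj, hKdef, Ideal.span_insert]
  have hKG : K ⊔ Ideal.span {Gj} = J' := by
    rw [hKdef, hJ'def, ← Ideal.span_insert]
    apply le_antisymm
    · rw [Ideal.span_le, Set.insert_subset_iff, Set.singleton_subset_iff]
      refine ⟨?_, Ideal.subset_span (by simp)⟩
      rw [SetLike.mem_coe, hpdTi]
      exact Ideal.add_mem _ (Ideal.subset_span (by simp))
        (Ideal.mul_mem_right _ _ (Ideal.subset_span (by simp)))
    · rw [Ideal.span_le, Set.insert_subset_iff, Set.singleton_subset_iff]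
      refine ⟨?_, Ideal.subset_span (by simp)⟩
      have hGi' : Gi = pd 2 κ i T - Gj * (X j + C (τ j)) := by rw [hpdTi]; ring
      rw [SetLike.mem_coe, hGi']
      exact Ideal.sub_mem _ (Ideal.subset_span (by simp))
        (Ideal.mul_mem_right _ _ (Ideal.subset_span (by simp)))
  have hJ' : (jac p 2 κ c).map (Θ : MvPowerSeries (Fin 2) κ →+* MvPowerSeries (Fin 2) κ) =
      Ideal.span {(X i : MvPowerSeries (Fin 2) κ) ^ p} * J' := by
    rw [jac_eq_span_pair hij, Ideal.map_span, Set.image_pair, hJ'def, Ideal.span_mul_span',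
      Set.singleton_mul, Set.image_pair]
    change Ideal.span {Θ (pd 2 κ i (ser p 2 κ c)), Θ (pd 2 κ j (ser p 2 κ c))} = _
    rw [hΘ, hΘ, hGi, hGj]
  -- finiteness
  haveI hfinJ : Module.Finite κ (MvPowerSeries (Fin 2) κ ⧸ jac p 2 κ c) := hI
  have hjac'_le : jac p 2 κ (step p 2 κ i τ c) ≤ J' := by
    rw [hjac', ← hKG]
    refine sup_le le_sup_left ?_
    rw [Ideal.span_singleton_le_iff_mem]
    exact Ideal.mem_sup_right (Ideal.mem_span_singleton'.mpr ⟨X i, by ring⟩)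
  haveI hfin' : Module.Finite κ (MvPowerSeries (Fin 2) κ ⧸ jac p 2 κ (step p 2 κ i τ c)) := hI'
  haveI hfinJ' : Module.Finite κ (MvPowerSeries (Fin 2) κ ⧸ J') := finite_quotient_of_le (κ := κ) hjac'_le
  -- the near point has high contact: slice of `T` vanishes below `X_j^p`
  have hslice : ∀ k, coeff (single i 1 + single j k) T =
      clean p 2 κ (step p 2 κ i τ c) ⇑(single i 1 + single j k : Fin 2 →₀ ℕ) := by
    intro k
    have h := congrArg (coeff (single j k)) (hpdT i)
    rw [MuDropSurface.coeff_pd, MuDropSurface.coeff_pd, coeff_ser] at h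
    have h1 : (((single j k : Fin 2 →₀ ℕ) i + 1 : ℕ) : κ) = 1 := by simp [hij]
    rw [h1, one_mul, one_mul, add_comm] at h
    exact h.symm
  have hvan : ∀ k, k < p → coeff (single i 1 + single j k) T = 0 := by
    intro k hk
    rw [hslice]
    by_contra hne
    rcases (Nat.succ_le_of_lt hk).eq_or_lt with hk1 | hk1
    · apply hO'
      refine ⟨_, hne, ?_⟩
      rw [sum_eq_degree, map_add, degree_single, degree_single]; omega
    · have := hM'.2 _ hne
      rw [sum_eq_degree, map_add, degree_single, degree_single] at this; omega
  have hne : ∃ l, l ≤ p + 1 ∧ coeff (single i (p + 1 - l) + single j l) (ser p 2 κ c) ≠ 0 := by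
    obtain ⟨A, hA, hsum⟩ := hS
    let e : Fin 2 →₀ ℕ := Finsupp.equivFunOnFinite.symm A
    have he : (⇑e : Fin 2 → ℕ) = A := by simp [e]
    have hdeg : e i + e j = p + 1 := by
      rw [← hsum, ← he, sum_eq_degree, degree_eq_add hij]
    refine ⟨e j, by omega, ?_⟩
    have hexp : (single i (p + 1 - e j) + single j (e j) : Fin 2 →₀ ℕ) = e := by
      ext l
      rcases OrdPExitSurface.eq_or_eq i j hij l with rfl | rfl
      · simp [hij]; omega
      · simp [hij.symm]
    rw [coeff_ser, hexp, he]
    exact hA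
  have hTdict : Θ (ser p 2 κ c) = X i ^ p * T := by rw [hΘ]; exact hdict
  -- a transversal element of `J`
  have htrans : ∃ f ∈ jac p 2 κ c, f ∉ Ideal.span {(X i : MvPowerSeries (Fin 2) κ)} ⊔ maximalIdeal _ ^ (p + 1) := by
    have key : ∀ f : MvPowerSeries (Fin 2) κ, coeff (single j p) f ≠ 0 →
        f ∉ Ideal.span {(X i : MvPowerSeries (Fin 2) κ)} ⊔ maximalIdeal _ ^ (p + 1) := by
      intro f hf hmem
      rcases Submodule.mem_sup.mp hmem with ⟨u, hu, v, hv, rfl⟩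
      obtain ⟨q, rfl⟩ := Ideal.mem_span_singleton'.mp hu
      apply hf
      rw [map_add, coeff_eq_zero_of_mem_maximalIdeal_pow hv (by rw [degree_single]; omega), add_zero,
        mul_comm]
      exact (MvPowerSeries.X_dvd_iff.mp (dvd_mul_right _ _)) _ (by simp [hij])
    rcases coeff_ne_zero_or_of_nearPoint hij (τ j) Θ hΘi hΘj ham hTdict hvan hne with h1 | h1
    · refine ⟨pd 2 κ j (ser p 2 κ c), ?_, key _ ?_⟩
      · rw [jac_eq_span_pair hij]; exact Ideal.subset_span (by simp)
      · haveI : Fact p.Prime := ⟨hp⟩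
        rw [MuDropSurface.coeff_pd, single_eq_same, ← single_add,
          show ((p + 1 : ℕ) : κ) = 1 by rw [Nat.cast_succ, CharP.cast_eq_zero, zero_add], one_mul]
        exact h1
    · refine ⟨pd 2 κ i (ser p 2 κ c), ?_, key _ ?_⟩
      · rw [jac_eq_span_pair hij]; exact Ideal.subset_span (by simp)
      · rw [MuDropSurface.coeff_pd, show ((single j p : Fin 2 →₀ ℕ) i + 1 : ℕ) = 1 by simp [hij],
          Nat.cast_one, one_mul, add_comm]
        exact h1
  obtain ⟨f, hfJ, hf⟩ := htrans
  -- the colength engine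
  have hdrop := finrank_quotient_weakTransform_add_lt hij (τ j) Θ hΘi hΘj hp.two_le hJm hfJ hf
    (pd 2 κ i (ser p 2 κ c)) (pd 2 κ j (ser p 2 κ c)) (jac_eq_span_pair hij c) hJ'
  -- `mu c' ≤ r + dim R/J'` with `r ≤ p + 1`
  have hsub : finrank κ (MvPowerSeries (Fin 2) κ ⧸ (K ⊔ Ideal.span {X i * Gj})) ≤
      finrank κ (MvPowerSeries (Fin 2) κ ⧸ (K ⊔ Ideal.span {(X i : MvPowerSeries (Fin 2) κ)})) +
        finrank κ (MvPowerSeries (Fin 2) κ ⧸ (K ⊔ Ideal.span {Gj})) := by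
    haveI : Module.Finite κ (MvPowerSeries (Fin 2) κ ⧸ (K ⊔ Ideal.span {X i * Gj})) := by rw [← hjac']; exact hI'
    exact finrank_quotient_sup_span_mul_le K (X i) Gj
  have hr : finrank κ (MvPowerSeries (Fin 2) κ ⧸ (K ⊔ Ideal.span {(X i : MvPowerSeries (Fin 2) κ)})) ≤ p + 1 :=
    finrank_quotient_span_sup_span_X_le_of_nearPoint hij (τ j) Θ hΘi hΘj ham hTdict hvan hne
      (D := pd 2 κ i T) (fun k => by
        rw [MuDropSurface.coeff_pd, show ((single j k : Fin 2 →₀ ℕ) i + 1 : ℕ) = 1 by simp [hij],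
          Nat.cast_one, one_mul, add_comm])
  -- `dim R/𝔪^p ≥ p + 1`
  have hmp : p + 1 ≤ finrank κ (MvPowerSeries (Fin 2) κ ⧸ maximalIdeal (MvPowerSeries (Fin 2) κ) ^ p) := by
    haveI : Module.Finite κ (MvPowerSeries (Fin 2) κ ⧸ maximalIdeal (MvPowerSeries (Fin 2) κ) ^ p) :=
      finite_quotient_maximalIdeal_pow (σ := Fin 2) (K := κ) p
    have hlt : maximalIdeal (MvPowerSeries (Fin 2) κ) ^ p <
        maximalIdeal (MvPowerSeries (Fin 2) κ) ^ p ⊔ Ideal.span {(X i : MvPowerSeries (Fin 2) κ)} := by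
      refine lt_of_le_of_ne le_sup_left fun heq => ?_
      have hXm : (X i : MvPowerSeries (Fin 2) κ) ∈ maximalIdeal (MvPowerSeries (Fin 2) κ) ^ p := by
        rw [heq]; exact Ideal.mem_sup_right (Ideal.mem_span_singleton_self _)
      exact X_not_mem_maximalIdeal_sq i (Ideal.pow_le_pow_right hp.two_le hXm)
    have h1 := finrank_quotient_lt_of_lt (κ := κ) hlt
    have h2 := succ_le_finrank_quotient_pow_succ_sup_span (κ := κ) hij (p - 1)
    rw [Nat.sub_add_cancel hp.one_le] at h2
    omega
  -- assemble
  have hmu' : mu p 2 κ (step p 2 κ i τ c) = finrank κ (MvPowerSeries (Fin 2) κ ⧸ (K ⊔ Ideal.span {X i * Gj})) := by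
    change finrank κ (MvPowerSeries (Fin 2) κ ⧸ jac p 2 κ (step p 2 κ i τ c)) = _
    rw [hjac']
  have hmu : mu p 2 κ c = finrank κ (MvPowerSeries (Fin 2) κ ⧸ jac p 2 κ c) := rfl
  rw [hKG] at hsub
  omega

end Summit.ResolutionOfSingularities.ResolutionOfSingularities.Theorems.WildCones

end
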